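import Literature.Geometry.Lorentzian.InverseMeanCurvatureFlowSemicontinuity
import Literature.Geometry.Lorentzian.InverseMeanCurvatureFlowConstancy
import HarnessLib

/-!
# Inverse mean curvature flow I — proofs: Huisken–Ilmanen's Compactness Theorem 2.1

Sorry-free proof of the **Compactness Theorem** for weak solutions of the level-set inverse mean
curvature flow (Huisken–Ilmanen, J. Differential Geom. 59 (2001), §2, Thm. 2.1, p. 21–22), for
the weak formulation of `InverseMeanCurvatureFlow.lean` (`IsWeakSolution`, (1.5)):

*Let `uᵢ` be weak solutions of (1.5) on open sets `Ωᵢ` of the Riemannian `3`-manifold `(X, h)`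
such that `uᵢ → u` locally uniformly on the open set `Ω`, every compact `K ⊆ Ω` lies in `Ωᵢ`
for large `i`, and the `uᵢ` satisfy locally uniform Lipschitz bounds on `Ω` for large `i`.
Then `u` is a weak solution of (1.5) on `Ω`* (`isWeakSolution_of_tendstoLocallyUniformlyOn`).

This is the second of the two general ingredients (with the Uniqueness Theorem 2.2,
`InverseMeanCurvatureFlowUniqueness.lean`) of the proof of the Weak Existence Theorem 3.1
(the named fact `weak_existence`), where it passes the solutions `u^ε` of the elliptic
regularisation to the limit `ε → 0`, `L → ∞`.

The proof is Huisken–Ilmanen's (p. 21–22), in the functional form of this series of files: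

1. (`IsWeakSolution.setIntegral_cutoff_le`) For a cutoff `φ ∈ C¹_c`, `0 ≤ φ ≤ 1`, and a locally
   Lipschitz `v`, testing the solution `uᵢ` against the competitor `φ v + (1 − φ) uᵢ`
   (locally Lipschitz by `isLocLipschitzOn_of_contMDiff`) gives
   `∫ φ(1 + uᵢ − v)|∇uᵢ| ≤ ∫ φ|∇v| + ∫ |v − uᵢ| |∇φ|` (the displayed inequality of loc. cit.), by
   the a.e. chain rule `|∇(φv + (1−φ)uᵢ)| ≤ φ|∇v| + (1−φ)|∇uᵢ| + |v−uᵢ||∇φ|`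
   (`gradNorm_cutoff_combination_le`).
2. (`setIntegral_cutoff_limit_le`) If `v ≤ u + 1` and `φ = 1` near `{v ≠ u}`, the last term tends
   to `0`, `∫ φ(uᵢ − u)|∇uᵢ| → 0` by the uniform gradient bound, and the lower semicontinuity of
   `∫ φ(1 + u − v)|∇·|` (`integral_mul_gradNorm_le_of_tendstoLocallyUniformlyOn`,
   `InverseMeanCurvatureFlowSemicontinuity.lean`) yields `∫ φ(1 + u − v)|∇u| ≤ ∫ φ|∇v|`, whence
   `J_u(u) ≤ J_u(v)` for competitors `v ≤ u + 1` (slopes agree a.e. on `{u = v}`).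
3. (`imcfEnergy_le_of_forall_le_add`) If (1.5) holds against competitors `w ≤ u + c` then it holds
   against `v ≤ u + 2c`: insert `min(v, u + c)` and `max(v − c, u)` and add, using
   `J_u(min(v, w)) + J_u(max(v, w)) = J_u(v) + J_u(w)`; induction on `c = 2^m` covers every
   competitor (step 2 of loc. cit.).

Hypotheses of the Lean statement: `Ω` and all `Ωᵢ` open; `uᵢ → u` locally uniformly on `Ω`
(`TendstoLocallyUniformlyOn`); exhaustion `∀ K ⊆ Ω compact, ∀ᶠ i, K ⊆ Ωᵢ`; and the local
Lipschitz bounds in the form "every `x ∈ Ω` has a neighbourhood on which the `uᵢ` are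
`C`-Lipschitz for the Riemannian distance for all large `i`" (Huisken–Ilmanen's
"`sup_K |∇uᵢ| ≤ C(K)` for large `i`", read for locally Lipschitz functions).

Everything is proved; there are no definitions and no named facts.

## References

* G. Huisken, T. Ilmanen, *The inverse mean curvature flow and the Riemannian Penrose
  inequality*, J. Differential Geom. 59 (2001) 353–437: §2, Compactness Theorem 2.1 and its
  proof, p. 21–22.
-/

noncomputable section

open Bundle Set Manifold TopologicalSpace Filter MeasureTheory Function
open scoped ContDiff Topology ENNReal NNReal Manifold Real

namespace Literature.Geometry.Lorentzian

open PseudoRiemannianMetric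

variable {X : Type*} [TopologicalSpace X] [ChartedSpace E3 X] [IsManifold (𝓡 3) ∞ X]

/-! ### The slope of the cutoff combination `φ v + (1 − φ) u` -/

section Slope

variable (h : ContMDiffRiemannianMetric (𝓡 3) ∞ E3 (TangentSpace (𝓡 3) : X → Type _))

set_option backward.isDefEq.respectTransparency false in
/-- **Slope of a three-term linear combination of differentials.** If
`dw_x = a dU_x + b dv_x + c dz_x` (for the `ℝ`-valued differentials `mvfderiv`) then
`|∇w|(x) ≤ |a| |∇U|(x) + |b| |∇v|(x) + |c| |∇z|(x)` (`|∇f| = ‖♯df‖`, `♯` linear, triangle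
inequality). [folklore] -/
theorem gradNorm_le_of_mvfderiv_eq₃ {w U v z : X → ℝ} {x : X} (a b c : ℝ)
    (hw : ∀ ξ, mvfderiv (𝓡 3) w x ξ =
      a * mvfderiv (𝓡 3) U x ξ + b * mvfderiv (𝓡 3) v x ξ + c * mvfderiv (𝓡 3) z x ξ) :
    gradNorm h w x ≤ |a| * gradNorm h U x + |b| * gradNorm h v x + |c| * gradNorm h z x := by
  letI : RiemannianBundle (fun x : X ↦ TangentSpace (𝓡 3) x) :=
    ⟨h.toContinuousRiemannianMetric.toRiemannianMetric⟩
  have key : ∀ α : Module.Dual ℝ (TangentSpace (𝓡 3) x),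
      Real.sqrt ((ofRiemannian h).innerDual x α α) = ‖(ofRiemannian h).sharp x α‖ := by
    intro α
    rw [← Real.sqrt_sq (norm_nonneg _), ← real_inner_self_eq_norm_sq]
    congr 1
    change α ((ofRiemannian h).sharp x α) = h.inner x _ _
    rw [← val_ofRiemannian, val_sharp_apply]
  unfold gradNorm
  set αw : Module.Dual ℝ (TangentSpace (𝓡 3) x) := (mfderiv (𝓡 3) 𝓘(ℝ, ℝ) w x).toLinearMap
    with hαw
  set αU : Module.Dual ℝ (TangentSpace (𝓡 3) x) := (mfderiv (𝓡 3) 𝓘(ℝ, ℝ) U x).toLinearMap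
    with hαU
  set αv : Module.Dual ℝ (TangentSpace (𝓡 3) x) := (mfderiv (𝓡 3) 𝓘(ℝ, ℝ) v x).toLinearMap
    with hαv
  set αz : Module.Dual ℝ (TangentSpace (𝓡 3) x) := (mfderiv (𝓡 3) 𝓘(ℝ, ℝ) z x).toLinearMap
    with hαz
  have hlin : αw = a • αU + b • αv + c • αz := by
    apply LinearMap.ext
    intro ξ
    have hξ := hw ξ
    simp only [mvfderiv_apply_eq_mfderiv] at hξ
    simp only [LinearMap.add_apply, LinearMap.smul_apply, smul_eq_mul]
    exact hξ
  rw [key, key, key, key, hlin, map_add, map_add, map_smul, map_smul, map_smul]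
  calc ‖a • (ofRiemannian h).sharp x αU + b • (ofRiemannian h).sharp x αv +
        c • (ofRiemannian h).sharp x αz‖
      ≤ ‖a • (ofRiemannian h).sharp x αU + b • (ofRiemannian h).sharp x αv‖ +
        ‖c • (ofRiemannian h).sharp x αz‖ := norm_add_le _ _
    _ ≤ ‖a • (ofRiemannian h).sharp x αU‖ + ‖b • (ofRiemannian h).sharp x αv‖ +
        ‖c • (ofRiemannian h).sharp x αz‖ := by gcongr; exact norm_add_le _ _
    _ = |a| * ‖(ofRiemannian h).sharp x αU‖ + |b| * ‖(ofRiemannian h).sharp x αv‖ +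
        |c| * ‖(ofRiemannian h).sharp x αz‖ := by
        rw [norm_smul, norm_smul, norm_smul, Real.norm_eq_abs, Real.norm_eq_abs, Real.norm_eq_abs]

omit [IsManifold (𝓡 3) ∞ X] in
set_option backward.isDefEq.respectTransparency false in
/-- **Differential of the cutoff combination.** For `φ, v, u` differentiable at `x`,
`d(φ v + (1 − φ) u)_x = φ(x) dv_x + (1 − φ(x)) du_x + (v(x) − u(x)) dφ_x` (Leibniz rule).
[folklore] -/
theorem mvfderiv_cutoff_combination {φ v u : X → ℝ} {x : X}
    (hφ : MDifferentiableAt (𝓡 3) 𝓘(ℝ, ℝ) φ x) (hv : MDifferentiableAt (𝓡 3) 𝓘(ℝ, ℝ) v x)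
    (hu : MDifferentiableAt (𝓡 3) 𝓘(ℝ, ℝ) u x) (ξ : TangentSpace (𝓡 3) x) :
    mvfderiv (𝓡 3) (fun y ↦ φ y * v y + (1 - φ y) * u y) x ξ =
      φ x * mvfderiv (𝓡 3) v x ξ + (1 - φ x) * mvfderiv (𝓡 3) u x ξ +
        (v x - u x) * mvfderiv (𝓡 3) φ x ξ := by
  have h1 : HasMFDerivAt (𝓡 3) 𝓘(ℝ, ℝ) (fun _ : X ↦ (1 : ℝ)) x
      (0 : TangentSpace (𝓡 3) x →L[ℝ] ℝ) := hasMFDerivAt_const 1 x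
  have hφ' := hφ.hasMFDerivAt
  have hv' := hv.hasMFDerivAt
  have hu' := hu.hasMFDerivAt
  have h1φ := h1.sub hφ'
  have hA := hφ'.mul hv'
  have hB := h1φ.mul hu'
  have hsum := hA.add hB
  have hfun : (fun y ↦ φ y * v y + (1 - φ y) * u y) =
      φ * v + ((fun _ : X ↦ (1 : ℝ)) - φ) * u := by
    funext y; simp
  rw [show mvfderiv (𝓡 3) (fun y ↦ φ y * v y + (1 - φ y) * u y) x ξ =
    ((by exact mfderiv (𝓡 3) 𝓘(ℝ, ℝ) (fun y ↦ φ y * v y + (1 - φ y) * u y) x :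
      TangentSpace (𝓡 3) x →L[ℝ] ℝ)) ξ from rfl, hfun, hsum.mfderiv]
  have eφ : ((by exact mfderiv (𝓡 3) 𝓘(ℝ, ℝ) φ x : TangentSpace (𝓡 3) x →L[ℝ] ℝ)) ξ =
      mvfderiv (𝓡 3) φ x ξ := rfl
  have ev : ((by exact mfderiv (𝓡 3) 𝓘(ℝ, ℝ) v x : TangentSpace (𝓡 3) x →L[ℝ] ℝ)) ξ =
      mvfderiv (𝓡 3) v x ξ := rfl
  have eu : ((by exact mfderiv (𝓡 3) 𝓘(ℝ, ℝ) u x : TangentSpace (𝓡 3) x →L[ℝ] ℝ)) ξ =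
      mvfderiv (𝓡 3) u x ξ := rfl
  simp only [add_apply, smul_apply, sub_apply, zero_apply, smul_eq_mul, Pi.sub_apply]
  rw [eφ, ev, eu]
  ring

/-- **A.e. chain rule for the cutoff combination**: at a point where `v` and `u` are
differentiable (and `φ ∈ C¹` with `0 ≤ φ ≤ 1` everywhere),
`|∇(φ v + (1 − φ) u)| ≤ φ |∇v| + (1 − φ) |∇u| + |v − u| |∇φ|`. This is the pointwise estimate
`|∇vᵢ| ≤ φ|∇v| + (1 − φ)|∇uᵢ| + |∇φ||v − uᵢ|` behind the displayed inequality in the proof of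
Huisken–Ilmanen's Thm. 2.1 (p. 21–22). [cite: HuiskenIlmanenIMCF2001, §2 proof of Thm. 2.1] -/
theorem gradNorm_cutoff_combination_le {φ v u : X → ℝ} {x : X}
    (hφ : MDifferentiableAt (𝓡 3) 𝓘(ℝ, ℝ) φ x) (hφ0 : 0 ≤ φ x) (hφ1 : φ x ≤ 1)
    (hv : MDifferentiableAt (𝓡 3) 𝓘(ℝ, ℝ) v x) (hu : MDifferentiableAt (𝓡 3) 𝓘(ℝ, ℝ) u x) :
    gradNorm h (fun y ↦ φ y * v y + (1 - φ y) * u y) x ≤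
      φ x * gradNorm h v x + (1 - φ x) * gradNorm h u x + |v x - u x| * gradNorm h φ x := by
  have := gradNorm_le_of_mvfderiv_eq₃ h (φ x) (1 - φ x) (v x - u x)
    (mvfderiv_cutoff_combination hφ hv hu)
  rwa [abs_of_nonneg hφ0, abs_of_nonneg (by linarith)] at this

end Slope

/-! ### Lipschitz bounds pass to pointwise limits -/

section LipschitzLimit

/-- **Equi-Lipschitz bounds pass to pointwise limits**: if eventually every `fᵢ` is `K`-Lipschitz
on `s` and `fᵢ → g` pointwise on `s`, then `g` is `K`-Lipschitz on `s` (the set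
`{(a, b) | edist a b ≤ K edist x y}` is closed). This gives the local Lipschitz continuity of the
limit `u` in Huisken–Ilmanen's Thm. 2.1. [folklore] -/
theorem lipschitzOnWith_of_tendsto {α : Type*} [PseudoEMetricSpace α] {f : ℕ → α → ℝ}
    {g : α → ℝ} {K : ℝ≥0} {s : Set α} (hf : ∀ᶠ i in atTop, LipschitzOnWith K (f i) s)
    (hg : ∀ x ∈ s, Tendsto (fun i ↦ f i x) atTop (𝓝 (g x))) : LipschitzOnWith K g s := by
  intro x hx y hy
  have hclosed : IsClosed {p : ℝ × ℝ | edist p.1 p.2 ≤ K * edist x y} :=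
    isClosed_le continuous_edist continuous_const
  have hmem : ∀ᶠ i in atTop, (f i x, f i y) ∈ {p : ℝ × ℝ | edist p.1 p.2 ≤ K * edist x y} := by
    filter_upwards [hf] with i hi using hi hx hy
  exact hclosed.mem_of_tendsto ((hg x hx).prodMk_nhds (hg y hy)) hmem

end LipschitzLimit

/-! ### Step 1a: testing a weak solution against the cutoff combination -/

section Cutoff

variable (h : ContMDiffRiemannianMetric (𝓡 3) ∞ E3 (TangentSpace (𝓡 3) : X → Type _))
  [T2Space X] [LocallyCompactSpace X] [MeasurableSpace X] [BorelSpace X]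
  [SecondCountableTopology X]

set_option backward.isDefEq.respectTransparency false in
/-- **The cutoff inequality** (Huisken–Ilmanen, proof of Thm. 2.1, step 1, p. 21–22). Let `u` be
a weak solution of (1.5) on the open set `Ω`, `v` locally Lipschitz on the open set `Ω'`, `S` a
compact subset of `Ω ∩ Ω'`, and `φ ∈ C¹` a cutoff with `0 ≤ φ ≤ 1` and `tsupport φ ⊆ S`. Then
`vᵢ = φ v + (1 − φ) u` "is a valid comparison function for `u`", and inserting it into (1.5) gives
`∫_S φ (1 + u − v) |∇u| ≤ ∫_S φ |∇v| + ∫_S |v − u| |∇φ|`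
(from `|∇vᵢ| ≤ φ|∇v| + (1 − φ)|∇u| + |v − u||∇φ|` a.e., `gradNorm_cutoff_combination_le`).
[cite: HuiskenIlmanenIMCF2001, §2 proof of Thm. 2.1 (step 1)] -/
theorem IsWeakSolution.setIntegral_cutoff_le {u v φ : X → ℝ} {Ω Ω' S : Set X} (hΩ : IsOpen Ω)
    (hΩ' : IsOpen Ω') (hu : IsWeakSolution h u Ω) (hv : IsLocLipschitzOn h v Ω')
    (hS : IsCompact S) (hSΩ : S ⊆ Ω) (hSΩ' : S ⊆ Ω') (hφ : ContMDiff (𝓡 3) 𝓘(ℝ, ℝ) 1 φ)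
    (hφ01 : ∀ x, φ x ∈ Icc (0 : ℝ) 1) (hφS : tsupport φ ⊆ S) :
    ∫ x in S, φ x * (1 + u x - v x) * gradNorm h u x ∂riemannianMeasure h ≤
      (∫ x in S, φ x * gradNorm h v x ∂riemannianMeasure h) +
        ∫ x in S, |v x - u x| * gradNorm h φ x ∂riemannianMeasure h := by
  set μ := riemannianMeasure h with hμ
  -- the open set `O = Ω ∩ Ω' ⊇ S` on which everything is locally Lipschitz
  set O := Ω ∩ Ω' with hO
  have hOo : IsOpen O := hΩ.inter hΩ'
  have hSO : S ⊆ O := fun x hx ↦ ⟨hSΩ hx, hSΩ' hx⟩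
  have huO : IsLocLipschitzOn h u O := hu.1.mono h inter_subset_left
  have hvO : IsLocLipschitzOn h v O := hv.mono h inter_subset_right
  have hφO : IsLocLipschitzOn h φ O := isLocLipschitzOn_of_contMDiff' h hφ O
  -- the competitor `w = φ v + (1 - φ) u`
  set w : X → ℝ := fun x ↦ φ x * v x + (1 - φ x) * u x with hw
  have hwO : IsLocLipschitzOn h w O :=
    (hφO.mul h hvO).add h (((isLocLipschitzOn_const h 1 O).sub h hφO).mul h huO)
  have hφ0' : ∀ x, x ∉ tsupport φ → w x = u x := fun x hx ↦ by
    have hφx : φ x = 0 := image_eq_zero_of_notMem_tsupport hx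
    simp [hw, hφx]
  have hwlip : IsLocLipschitzOn h w Ω :=
    isLocLipschitzOn_of_eqOn_of_eqOn h hOo (isClosed_tsupport φ) (hφS.trans hSO) hu.1 hwO
      (fun x _ ↦ rfl) (fun x hx ↦ hφ0' x hx.2)
  have hexc : {x | x ∈ Ω ∧ w x ≠ u x} ⊆ S := by
    intro x hx
    by_contra hxS
    exact hx.2 (hφ0' x fun h' ↦ hxS (hφS h'))
  have hcomp : IsCompetitor h u Ω w := ⟨hwlip, S, hS, hSΩ, hexc⟩
  have hJ := hu.2 w hcomp S hS hSΩ hexc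
  -- `0 ≤ J_u^S(w) - J_u^S(u)` as one integral
  have hIu := integrableOn_imcfEnergy_integrand h huO huO hOo hS hSO
  have hIw := integrableOn_imcfEnergy_integrand h huO hwO hOo hS hSO
  have hJ' : 0 ≤ ∫ x in S, ((gradNorm h w x + w x * gradNorm h u x) -
      (gradNorm h u x + u x * gradNorm h u x)) ∂μ := by
    rw [integral_sub hIw hIu]
    unfold imcfEnergy at hJ
    linarith
  -- the a.e. pointwise bound from the chain rule
  have hae : ∀ᵐ x ∂μ, x ∈ S →
      (gradNorm h w x + w x * gradNorm h u x) - (gradNorm h u x + u x * gradNorm h u x) ≤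
        φ x * gradNorm h v x + |v x - u x| * gradNorm h φ x -
          φ x * (1 + u x - v x) * gradNorm h u x := by
    filter_upwards [huO.ae_mdifferentiableAt h hOo, hvO.ae_mdifferentiableAt h hOo]
      with x hux hvx hxS
    have hxO := hSO hxS
    have hφd : MDifferentiableAt (𝓡 3) 𝓘(ℝ, ℝ) φ x := hφ.mdifferentiableAt one_ne_zero
    have hslope := gradNorm_cutoff_combination_le h hφd (hφ01 x).1 (hφ01 x).2 (hvx hxO) (hux hxO)
    have hwx : w x = φ x * v x + (1 - φ x) * u x := rfl
    have hww : gradNorm h w x = gradNorm h (fun y ↦ φ y * v y + (1 - φ y) * u y) x := rfl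
    rw [hwx, hww]
    nlinarith [hslope, gradNorm_nonneg h u x, (hφ01 x).1]
  -- integrate
  have hcu : ContinuousOn u S := (huO.continuousOn h).mono hSO
  have hcv : ContinuousOn v S := (hvO.continuousOn h).mono hSO
  have hcφ : ContinuousOn φ S := hφ.continuous.continuousOn
  have hIa : IntegrableOn (fun x ↦ φ x * gradNorm h v x) S μ :=
    hvO.integrableOn_mul_gradNorm h hOo hS hSO hcφ
  have hIb : IntegrableOn (fun x ↦ |v x - u x| * gradNorm h φ x) S μ :=
    hφO.integrableOn_mul_gradNorm h hOo hS hSO (hcv.sub hcu).abs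
  have hIc : IntegrableOn (fun x ↦ φ x * (1 + u x - v x) * gradNorm h u x) S μ :=
    huO.integrableOn_mul_gradNorm h hOo hS hSO (hcφ.mul ((continuousOn_const.add hcu).sub hcv))
  have hIab : IntegrableOn (fun x ↦ φ x * gradNorm h v x + |v x - u x| * gradNorm h φ x) S μ :=
    hIa.add hIb
  have hIabc : IntegrableOn (fun x ↦ φ x * gradNorm h v x + |v x - u x| * gradNorm h φ x -
      φ x * (1 + u x - v x) * gradNorm h u x) S μ := hIab.sub hIc
  have hmono : ∫ x in S, ((gradNorm h w x + w x * gradNorm h u x) -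
      (gradNorm h u x + u x * gradNorm h u x)) ∂μ ≤
      ∫ x in S, (φ x * gradNorm h v x + |v x - u x| * gradNorm h φ x -
        φ x * (1 + u x - v x) * gradNorm h u x) ∂μ :=
    integral_mono_ae (hIw.sub hIu) hIabc ((ae_restrict_iff' hS.measurableSet).2 hae)
  have hsplit : ∫ x in S, (φ x * gradNorm h v x + |v x - u x| * gradNorm h φ x -
        φ x * (1 + u x - v x) * gradNorm h u x) ∂μ =
      (∫ x in S, φ x * gradNorm h v x ∂μ) + (∫ x in S, |v x - u x| * gradNorm h φ x ∂μ) -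
        ∫ x in S, φ x * (1 + u x - v x) * gradNorm h u x ∂μ := by
    rw [integral_sub hIab hIc, integral_add hIa hIb]
  rw [hsplit] at hmono
  linarith

end Cutoff

/-! ### Step 1b: localisation to `{v ≠ u}` and the passage to the limit -/

section StepOne

variable (h : ContMDiffRiemannianMetric (𝓡 3) ∞ E3 (TangentSpace (𝓡 3) : X → Type _))
  [T2Space X] [LocallyCompactSpace X] [MeasurableSpace X] [BorelSpace X]
  [SecondCountableTopology X]

/-- **Localisation of the energy comparison to `{v ≠ U}`.** Let `U, v` be locally Lipschitz on the
open set `Ω`, `A = {x ∈ Ω | v x ≠ U x} ⊆ K ∩ S` (`K, S ⊆ Ω` compact) and `φ = 1` on `A`. Since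
`|∇v| = |∇U|` a.e. on `{v = U}` (`ae_gradNorm_eq_of_eq`), both `J_U^K(v) − J_U^K(U)` and
`∫_S φ|∇v| − ∫_S φ(1 + U − v)|∇U|` equal `∫_A (|∇v| − (1 + U − v)|∇U|)`; hence the limit
inequality `∫_S φ(1 + U − v)|∇U| ≤ ∫_S φ|∇v|` of Huisken–Ilmanen's proof of Thm. 2.1 yields
`J_U^K(U) ≤ J_U^K(v)` ("so `u` satisfies (1.5)", p. 22; "it does not matter which such set we
use", §1). [cite: HuiskenIlmanenIMCF2001, §2 proof of Thm. 2.1 (step 1)] -/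
theorem imcfEnergy_le_of_setIntegral_cutoff_le {U v φ : X → ℝ} {Ω S K : Set X} (hΩ : IsOpen Ω)
    (hU : IsLocLipschitzOn h U Ω) (hv : IsLocLipschitzOn h v Ω) (hS : IsCompact S) (hSΩ : S ⊆ Ω)
    (hK : IsCompact K) (hKΩ : K ⊆ Ω) (hvK : {x | x ∈ Ω ∧ v x ≠ U x} ⊆ K)
    (hvS : {x | x ∈ Ω ∧ v x ≠ U x} ⊆ S) (hφ1 : ∀ x ∈ Ω, v x ≠ U x → φ x = 1)
    (hφc : Continuous φ)
    (hineq : ∫ x in S, φ x * (1 + U x - v x) * gradNorm h U x ∂riemannianMeasure h ≤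
      ∫ x in S, φ x * gradNorm h v x ∂riemannianMeasure h) :
    imcfEnergy h U K U ≤ imcfEnergy h U K v := by
  set μ := riemannianMeasure h with hμ
  set A := {x | x ∈ Ω ∧ v x ≠ U x} with hA
  -- `A` is open (hence measurable)
  have hAo : IsOpen A := by
    have hc : ContinuousOn (fun x ↦ v x - U x) Ω := (hv.continuousOn h).sub (hU.continuousOn h)
    have := hc.isOpen_inter_preimage hΩ isOpen_compl_singleton (t := ({0} : Set ℝ)ᶜ)
    convert this using 1
    ext x
    simp only [hA, mem_setOf_eq, mem_inter_iff, mem_preimage, mem_compl_iff, mem_singleton_iff,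
      sub_eq_zero]
  have hAm : MeasurableSet A := hAo.measurableSet
  -- the integrand of `J_U(v) - J_U(U)` and its vanishing a.e. off `A`
  set D : X → ℝ := fun x ↦ (gradNorm h v x + v x * gradNorm h U x) -
    (gradNorm h U x + U x * gradNorm h U x) with hD
  have haeq := hv.ae_gradNorm_eq_of_eq h hU hΩ
  have hD0 : ∀ᵐ x ∂μ, x ∈ Ω → x ∉ A → D x = 0 := by
    filter_upwards [haeq] with x hx hxΩ hxA
    have hvU : v x = U x := by
      by_contra hne
      exact hxA ⟨hxΩ, hne⟩
    simp only [hD, hx hxΩ hvU, hvU]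
    ring
  -- `∫_K D = ∫_A D`
  have hKD : ∫ x in K, D x ∂μ = ∫ x in A, D x ∂μ := by
    have h1 : ∫ x in K, D x ∂μ = ∫ x in K, A.indicator D x ∂μ := by
      refine setIntegral_congr_ae hK.measurableSet ?_
      filter_upwards [hD0] with x hx hxK
      by_cases hxA : x ∈ A
      · rw [indicator_of_mem hxA]
      · rw [indicator_of_notMem hxA, hx (hKΩ hxK) hxA]
    rw [h1, setIntegral_indicator hAm, inter_eq_right.2 hvK]
  -- `∫_S (φ|∇v| - φ(1 + U - v)|∇U|) = ∫_A D`
  have hSD : ∫ x in S, (φ x * gradNorm h v x - φ x * (1 + U x - v x) * gradNorm h U x) ∂μ =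
      ∫ x in A, D x ∂μ := by
    have h1 : ∫ x in S, (φ x * gradNorm h v x - φ x * (1 + U x - v x) * gradNorm h U x) ∂μ =
        ∫ x in S, A.indicator D x ∂μ := by
      refine setIntegral_congr_ae hS.measurableSet ?_
      filter_upwards [haeq] with x hx hxS
      by_cases hxA : x ∈ A
      · rw [indicator_of_mem hxA, hφ1 x hxA.1 hxA.2]
        simp only [hD]
        ring
      · have hvU : v x = U x := by
          by_contra hne
          exact hxA ⟨hSΩ hxS, hne⟩
        rw [indicator_of_notMem hxA, hx (hSΩ hxS) hvU, hvU]
        ring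
    rw [h1, setIntegral_indicator hAm, inter_eq_right.2 hvS]
  -- integrability and conclusion
  have hIa : IntegrableOn (fun x ↦ φ x * gradNorm h v x) S μ :=
    hv.integrableOn_mul_gradNorm h hΩ hS hSΩ hφc.continuousOn
  have hIc : IntegrableOn (fun x ↦ φ x * (1 + U x - v x) * gradNorm h U x) S μ :=
    hU.integrableOn_mul_gradNorm h hΩ hS hSΩ (hφc.continuousOn.mul
      ((continuousOn_const.add ((hU.continuousOn h).mono hSΩ)).sub ((hv.continuousOn h).mono hSΩ)))
  have hpos : 0 ≤ ∫ x in S, (φ x * gradNorm h v x - φ x * (1 + U x - v x) * gradNorm h U x) ∂μ := by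
    rw [integral_sub hIa hIc]
    linarith
  have hIv := integrableOn_imcfEnergy_integrand h hU hv hΩ hK hKΩ
  have hIU := integrableOn_imcfEnergy_integrand h hU hU hΩ hK hKΩ
  have hfin : 0 ≤ ∫ x in K, D x ∂μ := by rw [hKD, ← hSD]; exact hpos
  have hsplit : ∫ x in K, D x ∂μ = imcfEnergy h U K v - imcfEnergy h U K U := by
    unfold imcfEnergy
    rw [← integral_sub hIv hIU]
  linarith

set_option backward.isDefEq.respectTransparency false in
/-- **Step 1 of the proof of the Compactness Theorem** (Huisken–Ilmanen 2001, p. 21–22): under the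
hypotheses of Thm. 2.1, the limit `U` satisfies `J_U^K(U) ≤ J_U^K(v)` for every competitor `v`
with `v ≤ U + 1`. With a cutoff `φ = 1` near `{v ≠ U}` supported in a compact `S ⊆ Ω`, the cutoff
inequality for `uᵢ` (`IsWeakSolution.setIntegral_cutoff_le`) reads
`∫_S φ(1 + uᵢ − v)|∇uᵢ| ≤ ∫_S φ|∇v| + ∫_S |v − uᵢ||∇φ|`; the last term tends to `0`
(`∇φ = 0` where `v ≠ U`, `uᵢ → U` uniformly on `S`), `∫_S φ|uᵢ − U||∇uᵢ| → 0` by the uniform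
gradient bound, and the lower semicontinuity of `∫ φ(1 + U − v)|∇·|`
(`integral_mul_gradNorm_le_of_tendstoLocallyUniformlyOn`) gives `∫_S φ(1 + U − v)|∇U| ≤ ∫_S φ|∇v|`,
which localises to `J_U^K(U) ≤ J_U^K(v)` (`imcfEnergy_le_of_setIntegral_cutoff_le`).
[cite: HuiskenIlmanenIMCF2001, §2 proof of Thm. 2.1 (step 1)] -/
theorem imcfEnergy_le_of_tendsto_of_le_add_one {u : ℕ → X → ℝ} {U : X → ℝ} {Ωs : ℕ → Set X}
    {Ω : Set X} (hΩ : IsOpen Ω) (hΩo : ∀ i, IsOpen (Ωs i))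
    (hsol : ∀ i, IsWeakSolution h (u i) (Ωs i))
    (hnest : ∀ K, IsCompact K → K ⊆ Ω → ∀ᶠ i in atTop, K ⊆ Ωs i)
    (hconv : TendstoLocallyUniformlyOn u U atTop Ω)
    (hlip : letI : RiemannianBundle (fun x : X ↦ TangentSpace (𝓡 3) x) :=
        ⟨h.toContinuousRiemannianMetric.toRiemannianMetric⟩
      letI : PseudoEMetricSpace X := .ofRiemannianMetric (𝓡 3) X
      ∀ x ∈ Ω, ∃ K : ℝ≥0, ∃ V ∈ 𝓝 x,
        (∀ᶠ i in atTop, LipschitzOnWith K (u i) V) ∧ LipschitzOnWith K U V)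
    (hU : IsLocLipschitzOn h U Ω) {v : X → ℝ} (hv : IsCompetitor h U Ω v)
    (hv1 : ∀ x ∈ Ω, v x ≤ U x + 1) {K : Set X} (hK : IsCompact K) (hKΩ : K ⊆ Ω)
    (hvK : {x | x ∈ Ω ∧ v x ≠ U x} ⊆ K) :
    imcfEnergy h U K U ≤ imcfEnergy h U K v := by
  letI : RiemannianBundle (fun x : X ↦ TangentSpace (𝓡 3) x) :=
    ⟨h.toContinuousRiemannianMetric.toRiemannianMetric⟩
  letI : PseudoEMetricSpace X := .ofRiemannianMetric (𝓡 3) X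
  set μ := riemannianMeasure h with hμ
  obtain ⟨hvlip, C, hC, hCΩ, hvC⟩ := hv
  -- nested relatively compact opens `C ⊆ W₁ ⊆ closure W₁ ⊆ W₂ ⊆ S := closure W₂ ⊆ Ω`
  obtain ⟨W₁, hW₁o, hCW₁, hW₁Ω, hW₁c⟩ := exists_open_between_and_isCompact_closure hC hΩ hCΩ
  obtain ⟨W₂, hW₂o, hW₁W₂, hW₂Ω, hW₂c⟩ := exists_open_between_and_isCompact_closure hW₁c hΩ hW₁Ω
  -- a smooth cutoff `φ = 1` on `closure W₁`, `φ = 0` off `W₂`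
  obtain ⟨φ, hφ0, hφ1, hφ01⟩ := exists_contMDiffMap_zero_one_of_isClosed (I := 𝓡 3)
    (n := (⊤ : ℕ∞)) hW₂o.isClosed_compl isClosed_closure (disjoint_compl_left_iff.2 hW₁W₂)
  have hφs : ContMDiff (𝓡 3) 𝓘(ℝ, ℝ) 1 φ := φ.contMDiff.of_le (by exact_mod_cast le_top)
  have hφcont : Continuous (φ : X → ℝ) := φ.contMDiff.continuous
  have hφsupp : tsupport (φ : X → ℝ) ⊆ closure W₂ :=
    closure_mono fun x hx ↦ by_contra fun hxW ↦ hx (hφ0 hxW)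
  have hφcs : HasCompactSupport (φ : X → ℝ) :=
    HasCompactSupport.of_support_subset_isCompact hW₂c ((subset_tsupport _).trans hφsupp)
  have hgradφ : ∀ x ∈ W₁, gradNorm h φ x = 0 := by
    intro x hx
    have hev : (φ : X → ℝ) =ᶠ[𝓝 x] fun _ ↦ (1 : ℝ) := by
      filter_upwards [hW₁o.mem_nhds hx] with y hy using hφ1 (subset_closure hy)
    rw [gradNorm_congr_of_eventuallyEq h hev, gradNorm_const]
  -- Lipschitz data, a finite subcover of `closure W₂`, a common index `N₀`
  choose! Kx Vx hVx hKu hKU using hlip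
  obtain ⟨t, htS, hScov⟩ := hW₂c.elim_nhds_subcover (fun x ↦ interior (Vx x))
    (fun x hx ↦ interior_mem_nhds.2 (hVx x (hW₂Ω hx)))
  have hev : ∀ᶠ i in atTop, closure W₂ ⊆ Ωs i ∧ ∀ x ∈ t, LipschitzOnWith (Kx x) (u i) (Vx x) :=
    (hnest _ hW₂c hW₂Ω).and ((Finset.eventually_all t).2 fun x hx ↦ hKu x (hW₂Ω (htS x hx)))
  obtain ⟨N₀, hN₀⟩ := eventually_atTop.1 hev
  -- the modified sequence `ũ i = u i` for `i ≥ N₀`, `= U` before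
  set ũ : ℕ → X → ℝ := fun i ↦ if N₀ ≤ i then u i else U with hũ
  have hũeq : ∀ i, N₀ ≤ i → ũ i = u i := fun i hi ↦ by simp [hũ, hi]
  have hũU : ∀ i, ¬ N₀ ≤ i → ũ i = U := fun i hi ↦ by simp [hũ, hi]
  have hLip : ∀ i, ∀ x ∈ t, LipschitzOnWith (Kx x) (ũ i) (interior (Vx x)) := by
    intro i x hxt
    by_cases hi : N₀ ≤ i
    · rw [hũeq i hi]; exact ((hN₀ i hi).2 x hxt).mono interior_subset
    · rw [hũU i hi]; exact (hKU x (hW₂Ω (htS x hxt))).mono interior_subset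
  -- the open set `O₃ ⊇ closure W₂` on which the `ũ i` are equi-Lipschitz near every point
  set O₃ := (⋃ x ∈ t, interior (Vx x)) ∩ Ω with hO₃
  have hO₃o : IsOpen O₃ := (isOpen_biUnion fun x _ ↦ isOpen_interior).inter hΩ
  have hSO₃ : closure W₂ ⊆ O₃ := fun y hy ↦ ⟨hScov hy, hW₂Ω hy⟩
  have hlipO₃ : ∀ y ∈ O₃, ∃ K' : ℝ≥0, ∃ V' ∈ 𝓝 y,
      (∀ i, LipschitzOnWith K' (ũ i) V') ∧ LipschitzOnWith K' U V' := by
    rintro y ⟨hy, -⟩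
    obtain ⟨x, hxt, hyx⟩ := mem_iUnion₂.1 hy
    exact ⟨Kx x, interior (Vx x), isOpen_interior.mem_nhds hyx, fun i ↦ hLip i x hxt,
      (hKU x (hW₂Ω (htS x hxt))).mono interior_subset⟩
  have hconvO₃ : TendstoLocallyUniformlyOn ũ U atTop O₃ := by
    refine (hconv.mono inter_subset_right).congr_inseparable ?_
    filter_upwards [eventually_ge_atTop N₀] with i hi y _
    rw [hũeq i hi]
  -- a uniform gradient bound on `closure W₂`
  set Cg : ℝ := ∑ x ∈ t, (Kx x : ℝ) with hCg
  have hCg0 : 0 ≤ Cg := Finset.sum_nonneg fun x _ ↦ NNReal.coe_nonneg _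
  have hgrad : ∀ i, ∀ y ∈ closure W₂, gradNorm h (ũ i) y ≤ Cg := by
    intro i y hy
    obtain ⟨x, hxt, hyx⟩ := mem_iUnion₂.1 (hScov hy)
    have h1 : gradNorm h (ũ i) y ≤ Kx x :=
      gradNorm_le_of_lipschitzOnWith h (isOpen_interior.mem_nhds hyx) (hLip i x hxt)
    exact h1.trans (Finset.single_le_sum (fun z _ ↦ NNReal.coe_nonneg (Kx z)) hxt)
  -- uniform convergence on `closure W₂`
  have hunif : TendstoUniformlyOn u U atTop (closure W₂) :=
    (tendstoLocallyUniformlyOn_iff_forall_isCompact hΩ).1 hconv _ hW₂Ω hW₂c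
  -- the weight `w = φ (1 + U - v) ≥ 0`, continuous with compact support in `closure W₂`
  set w : X → ℝ := fun x ↦ φ x * (1 + U x - v x) with hw
  have hwφ : ∀ x, x ∉ tsupport (φ : X → ℝ) → w x = 0 := fun x hx ↦ by
    simp [hw, image_eq_zero_of_notMem_tsupport hx]
  have hwsupp : tsupport w ⊆ tsupport (φ : X → ℝ) :=
    tsupport_mul_subset_left (f := (φ : X → ℝ)) (g := fun x ↦ 1 + U x - v x)
  have hwc : HasCompactSupport w := hφcs.mul_right
  have hw0 : ∀ x, 0 ≤ w x := by
    intro x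
    by_cases hx : x ∈ Ω
    · exact mul_nonneg (hφ01 x).1 (by linarith [hv1 x hx])
    · rw [hwφ x fun h' ↦ hx (hW₂Ω (hφsupp h'))]
  have hwcont : Continuous w := by
    rw [continuous_iff_continuousAt]
    intro x
    by_cases hx : x ∈ Ω
    · exact hφcont.continuousAt.mul ((continuousAt_const.add
        ((hU.continuousOn h).continuousAt (hΩ.mem_nhds hx))).sub
        ((hvlip.continuousOn h).continuousAt (hΩ.mem_nhds hx)))
    · have hx' : x ∉ tsupport (φ : X → ℝ) := fun h' ↦ hx (hW₂Ω (hφsupp h'))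
      have hev : (fun _ ↦ (0 : ℝ)) =ᶠ[𝓝 x] w := by
        filter_upwards [(isClosed_tsupport (φ : X → ℝ)).isOpen_compl.mem_nhds hx'] with y hy
        exact (hwφ y hy).symm
      exact continuousAt_const.congr hev
  -- the lower semicontinuity of `∫ w |∇·|` along `ũ i → U`
  have hlsc : ∀ {ε : ℝ}, 0 < ε → ∀ᶠ i in atTop, ∫ x, w x * gradNorm h U x ∂μ ≤
      (∫ x, w x * gradNorm h (ũ i) x ∂μ) + ε := fun hε ↦
    integral_mul_gradNorm_le_of_tendstoLocallyUniformlyOn h hO₃o hconvO₃ hlipO₃ hwcont hw0 hwc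
      (hwsupp.trans (hφsupp.trans hSO₃)) hε
  -- the cutoff inequality for `u i`, `i ≥ N₀`
  have hC1 : ∀ i, N₀ ≤ i →
      ∫ x in closure W₂, φ x * (1 + u i x - v x) * gradNorm h (u i) x ∂μ ≤
        (∫ x in closure W₂, φ x * gradNorm h v x ∂μ) +
          ∫ x in closure W₂, |v x - u i x| * gradNorm h φ x ∂μ := fun i hi ↦
    (hsol i).setIntegral_cutoff_le h (hΩo i) hΩ hvlip hW₂c (hN₀ i hi).1 hW₂Ω hφs hφ01 hφsupp
  -- whole-space vs. set integrals of `w`-weighted slopes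
  have hset : ∀ f : X → ℝ, ∫ x, w x * gradNorm h f x ∂μ =
      ∫ x in closure W₂, w x * gradNorm h f x ∂μ := fun f ↦
    (setIntegral_eq_integral_of_forall_compl_eq_zero fun x hx ↦ by
      rw [hwφ x (fun h' ↦ hx (hφsupp h')), zero_mul]).symm
  -- the passage to the limit: `∫_S w |∇U| ≤ ∫_S φ |∇v|`
  have hC5 : ∫ x in closure W₂, w x * gradNorm h U x ∂μ ≤
      ∫ x in closure W₂, φ x * gradNorm h v x ∂μ := by
    refine le_of_forall_pos_le_add fun ε hε ↦ ?_
    have hIφ : IntegrableOn (gradNorm h φ) (closure W₂) μ :=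
      (isLocLipschitzOn_of_contMDiff h hφs).integrableOn_gradNorm h isOpen_univ hW₂c (subset_univ _)
    have hint0 : 0 ≤ ∫ x in closure W₂, gradNorm h φ x ∂μ :=
      setIntegral_nonneg isClosed_closure.measurableSet fun x _ ↦ gradNorm_nonneg h φ x
    set M : ℝ := (∫ x in closure W₂, gradNorm h φ x ∂μ) + Cg * μ.real (closure W₂) + 1 with hM
    have hM0 : 0 < M := by
      have : 0 ≤ Cg * μ.real (closure W₂) := mul_nonneg hCg0 measureReal_nonneg
      linarith
    set δ : ℝ := (ε / 2) / M with hδ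
    have hδ0 : 0 < δ := div_pos (half_pos hε) hM0
    have hδM : δ * M = ε / 2 := by rw [hδ]; field_simp
    -- a good index `i`
    have hevU : ∀ᶠ i in atTop, ∀ y ∈ closure W₂, |u i y - U y| ≤ δ := by
      filter_upwards [(Metric.tendstoUniformlyOn_iff.1 hunif) δ hδ0] with i hi y hy
      have := hi y hy
      rw [Real.dist_eq, abs_sub_comm] at this
      exact this.le
    obtain ⟨i, hi₀, hilsc, hiU⟩ :=
      ((eventually_ge_atTop N₀).and ((hlsc (half_pos hε)).and hevU)).exists
    have hSΩi : closure W₂ ⊆ Ωs i := (hN₀ i hi₀).1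
    have hui : IsLocLipschitzOn h (u i) (Ωs i) := (hsol i).1
    -- (1) lower semicontinuity at the index `i`
    have h1 : ∫ x in closure W₂, w x * gradNorm h U x ∂μ ≤
        (∫ x in closure W₂, w x * gradNorm h (u i) x ∂μ) + ε / 2 := by
      have := hilsc
      rwa [hset U, hset (ũ i), hũeq i hi₀] at this
    -- (2) `∫ w|∇uᵢ| ≤ ∫ φ(1 + uᵢ - v)|∇uᵢ| + ∫ φ|uᵢ - U||∇uᵢ|`, then the cutoff inequality
    have hcS : ContinuousOn (u i) (closure W₂) := (hui.continuousOn h).mono hSΩi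
    have hcU : ContinuousOn U (closure W₂) := (hU.continuousOn h).mono hW₂Ω
    have hcv : ContinuousOn v (closure W₂) := (hvlip.continuousOn h).mono hW₂Ω
    have hcφ : ContinuousOn φ (closure W₂) := hφcont.continuousOn
    have hIw : IntegrableOn (fun x ↦ w x * gradNorm h (u i) x) (closure W₂) μ :=
      hui.integrableOn_mul_gradNorm h (hΩo i) hW₂c hSΩi hwcont.continuousOn
    have hI1 : IntegrableOn (fun x ↦ φ x * (1 + u i x - v x) * gradNorm h (u i) x) (closure W₂) μ :=
      hui.integrableOn_mul_gradNorm h (hΩo i) hW₂c hSΩi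
        (hcφ.mul ((continuousOn_const.add hcS).sub hcv))
    have hI2 : IntegrableOn (fun x ↦ φ x * |u i x - U x| * gradNorm h (u i) x) (closure W₂) μ :=
      hui.integrableOn_mul_gradNorm h (hΩo i) hW₂c hSΩi (hcφ.mul (hcS.sub hcU).abs)
    have hI12 : IntegrableOn (fun x ↦ φ x * (1 + u i x - v x) * gradNorm h (u i) x +
        φ x * |u i x - U x| * gradNorm h (u i) x) (closure W₂) μ := hI1.add hI2
    have h2 : ∫ x in closure W₂, w x * gradNorm h (u i) x ∂μ ≤
        (∫ x in closure W₂, φ x * gradNorm h v x ∂μ) +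
        (∫ x in closure W₂, |v x - u i x| * gradNorm h φ x ∂μ) +
        ∫ x in closure W₂, φ x * |u i x - U x| * gradNorm h (u i) x ∂μ := by
      have hpt : ∀ x, w x * gradNorm h (u i) x ≤ φ x * (1 + u i x - v x) * gradNorm h (u i) x +
          φ x * |u i x - U x| * gradNorm h (u i) x := by
        intro x
        have hg := gradNorm_nonneg h (u i) x
        have hφx := (hφ01 x).1
        have hwx : w x = φ x * (1 + U x - v x) := rfl
        rw [hwx]
        have key : 0 ≤ φ x * gradNorm h (u i) x * (u i x - U x + |u i x - U x|) :=
          mul_nonneg (mul_nonneg hφx hg) (by linarith [neg_le_abs (u i x - U x)])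
        nlinarith [key]
      have hmono := integral_mono hIw hI12 hpt
      rw [integral_add hI1 hI2] at hmono
      linarith [hC1 i hi₀]
    -- (3) `∫ |v - uᵢ||∇φ| ≤ δ ∫ |∇φ|` (`∇φ = 0` where `v ≠ U`, `|U - uᵢ| ≤ δ`)
    have hIb : IntegrableOn (fun x ↦ |v x - u i x| * gradNorm h φ x) (closure W₂) μ :=
      (isLocLipschitzOn_of_contMDiff h hφs).integrableOn_mul_gradNorm h isOpen_univ hW₂c
        (subset_univ _) (hcv.sub hcS).abs
    have h3 : ∫ x in closure W₂, |v x - u i x| * gradNorm h φ x ∂μ ≤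
        δ * ∫ x in closure W₂, gradNorm h φ x ∂μ := by
      rw [← integral_const_mul]
      refine setIntegral_mono_on hIb (hIφ.const_mul δ) isClosed_closure.measurableSet
        fun x hx ↦ ?_
      by_cases hvU : v x = U x
      · rw [hvU]
        exact mul_le_mul_of_nonneg_right ((abs_sub_comm (U x) (u i x)).le.trans (hiU x hx))
          (gradNorm_nonneg h φ x)
      · have hxW₁ : x ∈ W₁ := hCW₁ (hvC ⟨hW₂Ω hx, hvU⟩)
        rw [hgradφ x hxW₁, mul_zero, mul_zero]
    -- (4) `∫ φ|uᵢ - U||∇uᵢ| ≤ δ Cg μ(S)`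
    have h4 : ∫ x in closure W₂, φ x * |u i x - U x| * gradNorm h (u i) x ∂μ ≤
        δ * Cg * μ.real (closure W₂) := by
      have hb := norm_setIntegral_le_of_norm_le_const
        (riemannianVolume_lt_top_of_isCompact_holds h le_rfl hW₂c)
        (f := fun x ↦ φ x * |u i x - U x| * gradNorm h (u i) x) (C := δ * Cg) (fun x hx ↦ by
          rw [Real.norm_eq_abs, abs_mul, abs_mul, abs_abs, abs_of_nonneg (hφ01 x).1,
            abs_of_nonneg (gradNorm_nonneg h _ x)]
          have hg : gradNorm h (u i) x ≤ Cg := by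
            have := hgrad i x hx
            rwa [hũeq i hi₀] at this
          calc φ x * |u i x - U x| * gradNorm h (u i) x ≤ 1 * δ * Cg :=
                mul_le_mul (mul_le_mul (hφ01 x).2 (hiU x hx) (abs_nonneg _) zero_le_one) hg
                  (gradNorm_nonneg h _ x) (by positivity)
            _ = δ * Cg := by ring)
      rw [Real.norm_eq_abs] at hb
      exact (le_abs_self _).trans hb
    -- (5) bookkeeping
    have h5 : δ * (∫ x in closure W₂, gradNorm h φ x ∂μ) + δ * Cg * μ.real (closure W₂) ≤ ε / 2 := by
      calc δ * (∫ x in closure W₂, gradNorm h φ x ∂μ) + δ * Cg * μ.real (closure W₂)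
          = δ * ((∫ x in closure W₂, gradNorm h φ x ∂μ) + Cg * μ.real (closure W₂)) := by ring
        _ ≤ δ * M := mul_le_mul_of_nonneg_left (by rw [hM]; linarith) hδ0.le
        _ = ε / 2 := hδM
    linarith [h1, h2, h3, h4, h5]
  -- localisation
  have hvS : {x | x ∈ Ω ∧ v x ≠ U x} ⊆ closure W₂ :=
    hvC.trans (hCW₁.trans (subset_closure.trans (hW₁W₂.trans subset_closure)))
  have hφ1' : ∀ x ∈ Ω, v x ≠ U x → φ x = 1 := fun x hx hne ↦
    hφ1 (subset_closure (hCW₁ (hvC ⟨hx, hne⟩)))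
  exact imcfEnergy_le_of_setIntegral_cutoff_le h hΩ hU hvlip hW₂c hW₂Ω hK hKΩ hvK hvS hφ1'
    hφcont hC5

end StepOne

/-! ### Step 2: from competitors `v ≤ u + c` to all competitors -/

section StepTwo

variable (h : ContMDiffRiemannianMetric (𝓡 3) ∞ E3 (TangentSpace (𝓡 3) : X → Type _))
  [T2Space X] [LocallyCompactSpace X] [MeasurableSpace X] [BorelSpace X]
  [SecondCountableTopology X]

/-- **`J_u(min(v, w)) + J_u(max(v, w)) = J_u(v) + J_u(w)`** for `u, v, w` locally Lipschitz on the
open set `Ω ⊇ K` (`|∇max| + |∇min| = |∇v| + |∇w|` a.e., `max + min = v + w`). Huisken–Ilmanen 2001,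
§1, the identity displayed after (1.5), used in step 2 of the proof of Thm. 2.1 ("Adding these two
inequalities"). [cite: HuiskenIlmanenIMCF2001, §1 identity after (1.5)] -/
theorem imcfEnergy_inf_add_imcfEnergy_sup' {u v w : X → ℝ} {Ω K : Set X} (hΩ : IsOpen Ω)
    (hK : IsCompact K) (hKΩ : K ⊆ Ω) (hu : IsLocLipschitzOn h u Ω) (hv : IsLocLipschitzOn h v Ω)
    (hw : IsLocLipschitzOn h w Ω) :
    imcfEnergy h u K (fun x ↦ min (v x) (w x)) + imcfEnergy h u K (fun x ↦ max (v x) (w x)) =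
      imcfEnergy h u K v + imcfEnergy h u K w := by
  unfold imcfEnergy
  rw [← integral_add (integrableOn_imcfEnergy_integrand h hu (hv.inf h hw) hΩ hK hKΩ)
      (integrableOn_imcfEnergy_integrand h hu (hv.sup h hw) hΩ hK hKΩ),
    ← integral_add (integrableOn_imcfEnergy_integrand h hu hv hΩ hK hKΩ)
      (integrableOn_imcfEnergy_integrand h hu hw hΩ hK hKΩ)]
  refine integral_congr_ae ((ae_restrict_iff' hK.measurableSet).2 ?_)
  filter_upwards [hv.ae_gradNorm_sup_add_gradNorm_inf h hw hΩ] with x hx hxK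
  have h1 := hx (hKΩ hxK)
  have h2 : min (v x) (w x) + max (v x) (w x) = v x + w x := min_add_max _ _
  calc gradNorm h (fun x ↦ min (v x) (w x)) x + min (v x) (w x) * gradNorm h u x +
        (gradNorm h (fun x ↦ max (v x) (w x)) x + max (v x) (w x) * gradNorm h u x)
      = (gradNorm h (fun x ↦ max (v x) (w x)) x + gradNorm h (fun x ↦ min (v x) (w x)) x) +
          (min (v x) (w x) + max (v x) (w x)) * gradNorm h u x := by ring
    _ = (gradNorm h v x + gradNorm h w x) + (v x + w x) * gradNorm h u x := by rw [h1, h2]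
    _ = gradNorm h v x + v x * gradNorm h u x + (gradNorm h w x + w x * gradNorm h u x) := by ring

/-- **Translation of the competitor shifts the energy by `c ∫_K |∇u|`**:
`J_u^K(w + c) = J_u^K(w) + c ∫_K |∇u|` (`|∇(w + c)| = |∇w|`). [folklore] -/
theorem imcfEnergy_add_const_right {u w : X → ℝ} {Ω K : Set X} (hΩ : IsOpen Ω)
    (hK : IsCompact K) (hKΩ : K ⊆ Ω) (hu : IsLocLipschitzOn h u Ω) (hw : IsLocLipschitzOn h w Ω)
    (c : ℝ) :
    imcfEnergy h u K (fun x ↦ w x + c) =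
      imcfEnergy h u K w + c * ∫ x in K, gradNorm h u x ∂riemannianMeasure h := by
  unfold imcfEnergy
  rw [← integral_const_mul, ← integral_add (integrableOn_imcfEnergy_integrand h hu hw hΩ hK hKΩ)
    ((hu.integrableOn_gradNorm h hΩ hK hKΩ).const_mul c)]
  refine integral_congr_ae (Eventually.of_forall fun x ↦ ?_)
  simp only [gradNorm_add_const]
  ring

/-- **Step 2 of the proof of the Compactness Theorem** (Huisken–Ilmanen 2001, p. 22): if `U`
satisfies (1.5) against every competitor `w ≤ U + c` (`c ≥ 0`), then it satisfies (1.5) against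
every competitor `v ≤ U + 2c`. Insert `v₁ = min(v, U + c)` and `v₂ = max(v − c, U)`, both
`≤ U + c` and differing from `U` only where `v` does, and add:
`J_U(v₁) + J_U(v₂) = J_U(v) + J_U(U)` (`imcfEnergy_inf_add_imcfEnergy_sup'`,
`imcfEnergy_add_const_right`), so `2 J_U(U) ≤ J_U(v) + J_U(U)`.
[cite: HuiskenIlmanenIMCF2001, §2 proof of Thm. 2.1 (step 2)] -/
theorem imcfEnergy_le_of_forall_le_add {U : X → ℝ} {Ω : Set X} (hΩ : IsOpen Ω)
    (hU : IsLocLipschitzOn h U Ω) {c : ℝ} (hc : 0 ≤ c)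
    (IH : ∀ w, IsCompetitor h U Ω w → (∀ x ∈ Ω, w x ≤ U x + c) →
      ∀ K, IsCompact K → K ⊆ Ω → {x | x ∈ Ω ∧ w x ≠ U x} ⊆ K →
        imcfEnergy h U K U ≤ imcfEnergy h U K w)
    {v : X → ℝ} (hv : IsCompetitor h U Ω v) (hvle : ∀ x ∈ Ω, v x ≤ U x + 2 * c)
    {K : Set X} (hK : IsCompact K) (hKΩ : K ⊆ Ω) (hvK : {x | x ∈ Ω ∧ v x ≠ U x} ⊆ K) :
    imcfEnergy h U K U ≤ imcfEnergy h U K v := by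
  obtain ⟨hvlip, C, hC, hCΩ, hvC⟩ := hv
  have hUc : IsLocLipschitzOn h (fun x ↦ U x + c) Ω := hU.add_const h c
  -- the two competitors
  set v₁ : X → ℝ := fun x ↦ min (v x) (U x + c) with hv₁
  set v₂ : X → ℝ := fun x ↦ max (v x - c) (U x) with hv₂
  have hv₁lip : IsLocLipschitzOn h v₁ Ω := hvlip.inf h hUc
  have hv₂lip : IsLocLipschitzOn h v₂ Ω := (hvlip.sub h (isLocLipschitzOn_const h c Ω)).sup h hU
  have hv₁ne : ∀ x, v₁ x ≠ U x → v x ≠ U x := fun x hx hvU ↦ hx (by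
    simp only [hv₁, hvU]
    exact min_eq_left (by linarith))
  have hv₂ne : ∀ x, v₂ x ≠ U x → v x ≠ U x := fun x hx hvU ↦ hx (by
    simp only [hv₂, hvU]
    exact max_eq_right (by linarith))
  have hv₁comp : IsCompetitor h U Ω v₁ :=
    ⟨hv₁lip, C, hC, hCΩ, fun x hx ↦ hvC ⟨hx.1, hv₁ne x hx.2⟩⟩
  have hv₂comp : IsCompetitor h U Ω v₂ :=
    ⟨hv₂lip, C, hC, hCΩ, fun x hx ↦ hvC ⟨hx.1, hv₂ne x hx.2⟩⟩
  have hv₁le : ∀ x ∈ Ω, v₁ x ≤ U x + c := fun x _ ↦ min_le_right _ _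
  have hv₂le : ∀ x ∈ Ω, v₂ x ≤ U x + c := fun x hx ↦
    max_le (by linarith [hvle x hx]) (by linarith)
  have hv₁K : {x | x ∈ Ω ∧ v₁ x ≠ U x} ⊆ K := fun x hx ↦ hvK ⟨hx.1, hv₁ne x hx.2⟩
  have hv₂K : {x | x ∈ Ω ∧ v₂ x ≠ U x} ⊆ K := fun x hx ↦ hvK ⟨hx.1, hv₂ne x hx.2⟩
  have hJ₁ := IH v₁ hv₁comp hv₁le K hK hKΩ hv₁K
  have hJ₂ := IH v₂ hv₂comp hv₂le K hK hKΩ hv₂K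
  -- the identity `J(v₁) + J(v₂) = J(v) + J(U)`
  have hsum := imcfEnergy_inf_add_imcfEnergy_sup' h hΩ hK hKΩ hU hvlip hUc
  have hshift₁ := imcfEnergy_add_const_right h hΩ hK hKΩ hU hU c
  have hshift₂ := imcfEnergy_add_const_right h hΩ hK hKΩ hU hv₂lip c
  have hmax : (fun x ↦ max (v x) (U x + c)) = fun x ↦ v₂ x + c := by
    funext x
    show max (v x) (U x + c) = max (v x - c) (U x) + c
    rw [← max_add_add_right, sub_add_cancel]
  rw [hmax, hshift₂, hshift₁] at hsum
  have e₁ : imcfEnergy h U K v₁ = imcfEnergy h U K (fun x ↦ min (v x) (U x + c)) := rfl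
  linarith [hJ₁, hJ₂, hsum, e₁]

/-- **All competitors from competitors `v ≤ U + 1`** (end of the proof of Huisken–Ilmanen's
Thm. 2.1): if `U` is locally Lipschitz on the open set `Ω` and satisfies (1.5) against every
competitor `v ≤ U + 1`, then `U` is a weak solution on `Ω`. By `imcfEnergy_le_of_forall_le_add`
and induction, (1.5) holds against competitors `v ≤ U + 2^m` for every `m`, and every competitor
satisfies such a bound (`v − U` is continuous on the compact set containing `{v ≠ U}`).
[cite: HuiskenIlmanenIMCF2001, §2 proof of Thm. 2.1 (step 2)] -/
theorem isWeakSolution_of_forall_le_add_one {U : X → ℝ} {Ω : Set X} (hΩ : IsOpen Ω)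
    (hU : IsLocLipschitzOn h U Ω)
    (H1 : ∀ v, IsCompetitor h U Ω v → (∀ x ∈ Ω, v x ≤ U x + 1) →
      ∀ K, IsCompact K → K ⊆ Ω → {x | x ∈ Ω ∧ v x ≠ U x} ⊆ K →
        imcfEnergy h U K U ≤ imcfEnergy h U K v) :
    IsWeakSolution h U Ω := by
  -- (1.5) against competitors `v ≤ U + 2^m`, by induction on `m`
  have hP : ∀ m : ℕ, ∀ v, IsCompetitor h U Ω v → (∀ x ∈ Ω, v x ≤ U x + 2 ^ m) →
      ∀ K, IsCompact K → K ⊆ Ω → {x | x ∈ Ω ∧ v x ≠ U x} ⊆ K →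
        imcfEnergy h U K U ≤ imcfEnergy h U K v := by
    intro m
    induction m with
    | zero =>
      intro v hv hvle K hK hKΩ hvK
      exact H1 v hv (fun x hx ↦ by simpa using hvle x hx) K hK hKΩ hvK
    | succ m ih =>
      intro v hv hvle K hK hKΩ hvK
      refine imcfEnergy_le_of_forall_le_add h hΩ hU (c := 2 ^ m) (by positivity) ih hv
        (fun x hx ↦ ?_) hK hKΩ hvK
      have := hvle x hx
      rw [pow_succ] at this
      linarith
  refine ⟨hU, fun v hv K hK hKΩ hvK ↦ ?_⟩
  -- `v - U` is bounded above on the compact set containing `{v ≠ U}`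
  obtain ⟨hvlip, C, hC, hCΩ, hvC⟩ := hv
  have hcont : ContinuousOn (fun x ↦ v x - U x) C :=
    ((hvlip.continuousOn h).sub (hU.continuousOn h)).mono hCΩ
  obtain ⟨M, hM⟩ := (hC.bddAbove_image hcont)
  obtain ⟨m, hm⟩ := exists_nat_gt M
  have hm' : M ≤ 2 ^ m := by
    have h2 : (m : ℝ) < 2 ^ m := by exact_mod_cast Nat.lt_two_pow_self
    linarith
  refine hP m v ⟨hvlip, C, hC, hCΩ, hvC⟩ (fun x hx ↦ ?_) K hK hKΩ hvK
  by_cases hne : v x = U x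
  · rw [hne]
    have : (0 : ℝ) ≤ 2 ^ m := by positivity
    linarith
  · have hxC : x ∈ C := hvC ⟨hx, hne⟩
    have : v x - U x ≤ M := hM (mem_image_of_mem _ hxC)
    linarith

end StepTwo

/-! ### The Compactness Theorem -/

section Compactness

variable (h : ContMDiffRiemannianMetric (𝓡 3) ∞ E3 (TangentSpace (𝓡 3) : X → Type _))
  [T2Space X] [LocallyCompactSpace X] [MeasurableSpace X] [BorelSpace X]
  [SecondCountableTopology X]

set_option backward.isDefEq.respectTransparency false in
/-- **Compactness Theorem for weak solutions of inverse mean curvature flow**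
(Huisken–Ilmanen, J. Differential Geom. 59 (2001), Thm. 2.1): *Let `uᵢ` be a sequence of
solutions of (1.5) on open sets `Ωᵢ` in `M` such that `uᵢ → u` locally uniformly, `Ωᵢ → Ω`, and
for each `K ⊂⊂ Ω`, `sup_K |∇uᵢ| ≤ C(K)` for large `i`. Then `u` is a solution of (1.5) on `Ω`.*
Here: `X` a Riemannian `3`-manifold, `Ω` and the `Ωᵢ` open, `Ωᵢ → Ω` read as "every compact
`K ⊆ Ω` lies in `Ωᵢ` for large `i`", and the gradient bounds read as local uniform Lipschitz
bounds for the Riemannian distance (every `x ∈ Ω` has a neighbourhood on which the `uᵢ` are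
`C`-Lipschitz for large `i`); the conclusion `IsWeakSolution h u Ω` includes the local Lipschitz
continuity of `u` on `Ω` (`lipschitzOnWith_of_tendsto`). Proof: steps 1 and 2 of loc. cit.
(`imcfEnergy_le_of_tendsto_of_le_add_one`, `isWeakSolution_of_forall_le_add_one`).
[cite: HuiskenIlmanenIMCF2001, Thm. 2.1] -/
theorem isWeakSolution_of_tendstoLocallyUniformlyOn {u : ℕ → X → ℝ} {U : X → ℝ}
    {Ωs : ℕ → Set X} {Ω : Set X} (hΩ : IsOpen Ω) (hΩo : ∀ i, IsOpen (Ωs i))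
    (hsol : ∀ i, IsWeakSolution h (u i) (Ωs i))
    (hnest : ∀ K, IsCompact K → K ⊆ Ω → ∀ᶠ i in atTop, K ⊆ Ωs i)
    (hconv : TendstoLocallyUniformlyOn u U atTop Ω)
    (hlip : letI : RiemannianBundle (fun x : X ↦ TangentSpace (𝓡 3) x) :=
        ⟨h.toContinuousRiemannianMetric.toRiemannianMetric⟩
      letI : PseudoEMetricSpace X := .ofRiemannianMetric (𝓡 3) X
      ∀ x ∈ Ω, ∃ K : ℝ≥0, ∃ V ∈ 𝓝 x, ∀ᶠ i in atTop, LipschitzOnWith K (u i) V) :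
    IsWeakSolution h U Ω := by
  letI : RiemannianBundle (fun x : X ↦ TangentSpace (𝓡 3) x) :=
    ⟨h.toContinuousRiemannianMetric.toRiemannianMetric⟩
  letI : PseudoEMetricSpace X := .ofRiemannianMetric (𝓡 3) X
  -- the limit is Lipschitz wherever the `uᵢ` are equi-Lipschitz
  have hlip' : ∀ x ∈ Ω, ∃ K : ℝ≥0, ∃ V ∈ 𝓝 x,
      (∀ᶠ i in atTop, LipschitzOnWith K (u i) V) ∧ LipschitzOnWith K U V := by
    intro x hx
    obtain ⟨K, V, hV, hK⟩ := hlip x hx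
    refine ⟨K, V ∩ Ω, inter_mem hV (hΩ.mem_nhds hx), hK.mono fun i hi ↦ hi.mono inter_subset_left,
      lipschitzOnWith_of_tendsto (hK.mono fun i hi ↦ hi.mono inter_subset_left) fun y hy ↦ ?_⟩
    exact hconv.tendsto_at hy.2
  have hU : IsLocLipschitzOn h U Ω := isLocLipschitzOn_of_forall_exists_nhds h fun x hx ↦ by
    obtain ⟨K, V, hV, -, hK⟩ := hlip' x hx
    exact ⟨K, V, hV, hK⟩
  -- step 1 and step 2
  exact isWeakSolution_of_forall_le_add_one h hΩ hU fun v hv hv1 K hK hKΩ hvK ↦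
    imcfEnergy_le_of_tendsto_of_le_add_one h hΩ hΩo hsol hnest hconv hlip' hU hv hv1 hK hKΩ hvK

end Compactness





end Literature.Geometry.Lorentzian

end
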